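import Summits.RiemannHypothesis.RiemannHypothesis.Theorems.GroundBartaEvenWinsBeyondArchDeflationCrossGlue2
import HarnessLib

/-!
# RiemannHypothesis / GroundBarta — rung 4 (`EvenWinsBeyondArch`, stmt-RiemannHypothesis-18807 / 18085):
# the deflated Temple L-side — WEIGHTED residual Gram entries from panel bounds

Helper file (`--supports stmt-RiemannHypothesis-18807`), RH-free, no facts.  Prover B, speedrun unit `sr-gb-rung-b` (gen 4).
Prover A's weighted-Gram criterion (`dt_m7x_oddLower_of_gramW`, edge-only sliver) needs `sW_i ≥ ∫ w‖r_i‖²` and boxes for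
`∫ w·Re(r_i r̄_j)` with the two-valued weight `w = {y₁ ≤ |y|}.piecewise wE wI`.  With `y₁ = 2 n₁ h` on the panel grid the weight is
constant on every y-panel (`wI` for `j < n₁`, `wE` for `j ≥ n₁`), so the per-panel bounds of the unweighted layer are simply rescaled;
this file provides the assembly (`w` is even, bounded, measurable) and the per-panel rescaling lemmas.
-/

set_option linter.dupNamespace false

noncomputable section

open MeasureTheory Set Filter intervalIntegral
open scoped Topology BigOperators ComplexConjugate

namespace Summit.RiemannHypothesis.RiemannHypothesis.Theorems.EvenWinsBeyondArch

open Literature.NumberTheory.LFunctions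
open Literature.Analysis.ValidatedNumerics Literature.Analysis.ValidatedNumerics.PolyMP
  Literature.Analysis.ValidatedNumerics.NumericsMP Literature.Analysis.ValidatedNumerics.ExpPoly

section Weight

/-- The two-valued weight `w(y) = wE` for `y₁ ≤ |y|`, `wI` otherwise. -/
def dt_wgt (y₁ wI wE : ℝ) (y : ℝ) : ℝ := {u : ℝ | y₁ ≤ |u|}.piecewise (fun _ ↦ wE) (fun _ ↦ wI) y

/-- `dt_wgt` is prover A's `piecewise` weight (definitional). -/
theorem dt_wgt_eq (y₁ wI wE y : ℝ) :
    {u : ℝ | y₁ ≤ |u|}.piecewise (fun _ ↦ wE) (fun _ ↦ wI) y = dt_wgt y₁ wI wE y := rfl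

/-- The weight is even. -/
theorem dt_wgt_neg (y₁ wI wE y : ℝ) : dt_wgt y₁ wI wE (-y) = dt_wgt y₁ wI wE y := by
  classical
  simp only [dt_wgt, Set.piecewise, Set.mem_setOf_eq, abs_neg]

/-- Value on the edge region. -/
theorem dt_wgt_of_le {y₁ wI wE y : ℝ} (h : y₁ ≤ |y|) : dt_wgt y₁ wI wE y = wE := by
  classical
  simp only [dt_wgt, Set.piecewise, Set.mem_setOf_eq, if_pos h]

/-- Value on the interior region. -/
theorem dt_wgt_of_lt {y₁ wI wE y : ℝ} (h : |y| < y₁) : dt_wgt y₁ wI wE y = wI := by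
  classical
  simp only [dt_wgt, Set.piecewise, Set.mem_setOf_eq, if_neg (not_le.2 h)]

/-- The weight is measurable. -/
theorem dt_wgt_measurable (y₁ wI wE : ℝ) : Measurable (dt_wgt y₁ wI wE) := by
  classical
  refine Measurable.piecewise ?_ measurable_const measurable_const
  exact measurableSet_le measurable_const (measurable_id.abs)

/-- The weight is bounded by `|wI| + |wE|`. -/
theorem dt_wgt_abs_le (y₁ wI wE y : ℝ) : |dt_wgt y₁ wI wE y| ≤ |wI| + |wE| := by
  classical
  unfold dt_wgt Set.piecewise
  split_ifs
  · linarith [abs_nonneg wI]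
  · linarith [abs_nonneg wE]

/-- On panel `j < n₁` (with `y₁ = 2 n₁ h`) the weight is `wI`. -/
theorem dt_wgt_panel_interior {h : ℝ} (hh : 0 < h) {n₁ j : ℕ} (hj : j + 1 ≤ n₁) (wI wE : ℝ) {ρ : ℝ} (hρ : ρ ∈ Ioo (-h) h) :
    dt_wgt (2 * n₁ * h) wI wE ((2 * j + 1) * h + ρ) = wI := by
  refine dt_wgt_of_lt (abs_lt.2 ⟨?_, ?_⟩)
  · have hj0 : (0 : ℝ) ≤ j := by exact_mod_cast Nat.zero_le j
    have hn : (0 : ℝ) ≤ n₁ := by exact_mod_cast Nat.zero_le n₁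
    nlinarith [hρ.1]
  · have hj1 : (j : ℝ) + 1 ≤ n₁ := by exact_mod_cast hj
    nlinarith [hρ.2]

/-- On panel `j ≥ n₁` the weight is `wE`. -/
theorem dt_wgt_panel_edge {h : ℝ} (hh : 0 < h) {n₁ j : ℕ} (hj : n₁ ≤ j) (wI wE : ℝ) {ρ : ℝ} (hρ : ρ ∈ Ioo (-h) h) :
    dt_wgt (2 * n₁ * h) wI wE ((2 * j + 1) * h + ρ) = wE := by
  refine dt_wgt_of_le ?_
  have hj1 : (n₁ : ℝ) ≤ j := by exact_mod_cast hj
  rw [abs_of_pos (by nlinarith [hρ.1, (by exact_mod_cast Nat.zero_le j : (0 : ℝ) ≤ j)])]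
  nlinarith [hρ.1]

/-- **Per-panel rescaling (square).**  If `w(y_j + ρ) = κ ≥ 0` on the open panel and `∫ R² ≤ q`, then `∫ w R² ≤ κ q`. -/
theorem dt_wpanel_sq_le {h : ℝ} (hh : 0 ≤ h) {w R : ℝ → ℝ} {y κ q : ℝ} (hκ : 0 ≤ κ) (hw : ∀ ρ ∈ Ioo (-h) h, w (y + ρ) = κ)
    (hq : ∫ ρ in (-h)..h, R (y + ρ) ^ 2 ≤ q) :
    ∫ ρ in (-h)..h, w (y + ρ) * R (y + ρ) ^ 2 ≤ κ * q := by
  have e : ∫ ρ in (-h)..h, w (y + ρ) * R (y + ρ) ^ 2 = ∫ ρ in (-h)..h, κ * R (y + ρ) ^ 2 := by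
    refine intervalIntegral.integral_congr_ae ?_
    have hne : ∀ᵐ ρ : ℝ ∂volume, ρ ≠ h := by rw [ae_iff]; simp
    filter_upwards [hne] with ρ hρne hρ
    rw [uIoc_of_le (by linarith)] at hρ
    rw [hw ρ ⟨hρ.1, lt_of_le_of_ne hρ.2 hρne⟩]
  rw [e, intervalIntegral.integral_const_mul]
  exact mul_le_mul_of_nonneg_left hq hκ

/-- **Per-panel rescaling (cross).**  If `w(y_j + ρ) = κ ≥ 0` on the open panel and `lo ≤ ∫ Ri Rk ≤ hi`, then
`κ lo ≤ ∫ w Ri Rk ≤ κ hi`. -/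
theorem dt_wpanel_mul_mem {h : ℝ} (hh : 0 ≤ h) {w Ri Rk : ℝ → ℝ} {y κ lo hi : ℝ} (hκ : 0 ≤ κ) (hw : ∀ ρ ∈ Ioo (-h) h, w (y + ρ) = κ)
    (hlo : lo ≤ ∫ ρ in (-h)..h, Ri (y + ρ) * Rk (y + ρ)) (hhi : ∫ ρ in (-h)..h, Ri (y + ρ) * Rk (y + ρ) ≤ hi) :
    κ * lo ≤ ∫ ρ in (-h)..h, w (y + ρ) * (Ri (y + ρ) * Rk (y + ρ)) ∧
      ∫ ρ in (-h)..h, w (y + ρ) * (Ri (y + ρ) * Rk (y + ρ)) ≤ κ * hi := by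
  have e : ∫ ρ in (-h)..h, w (y + ρ) * (Ri (y + ρ) * Rk (y + ρ)) = ∫ ρ in (-h)..h, κ * (Ri (y + ρ) * Rk (y + ρ)) := by
    refine intervalIntegral.integral_congr_ae ?_
    have hne : ∀ᵐ ρ : ℝ ∂volume, ρ ≠ h := by rw [ae_iff]; simp
    filter_upwards [hne] with ρ hρne hρ
    rw [uIoc_of_le (by linarith)] at hρ
    rw [hw ρ ⟨hρ.1, lt_of_le_of_ne hρ.2 hρne⟩]
  rw [e, intervalIntegral.integral_const_mul]
  exact ⟨mul_le_mul_of_nonneg_left hlo hκ, mul_le_mul_of_nonneg_left hhi hκ⟩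

end Weight

section WAssembly

variable {c : ℝ} {k : ℕ}

/-- **Weighted residual norm from panel bounds**: `∫ w ‖r_i‖² ≤ 2 Σ qw_j` given `∫_{-h}^{h} w(y_j+ρ) R(y_j+ρ)² dρ ≤ qw_j`
(`w` even, bounded, measurable — e.g. `dt_wgt`). [cite: GoerischHaunhorst1985, §2] -/
theorem dt_residual_wnormSq_le_of_panels (hc : 0 < c) {σ : ℝ} (hσ : σ = 1 ∨ σ = -1)
    (g : Fin k → ℝ → ℝ) (hg : ∀ i, ContDiff ℝ 2 (g i)) (hgp : ∀ i x, g i (-x) = σ * g i x)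
    (v F : Fin k → ℝ → ℂ) (hv : ∀ i x, v i x = (((Icc (-c) c).indicator (g i) x : ℝ) : ℂ))
    (hF : ∀ i y, F i y = (Icc (-c) c).indicator (fun y ↦
        2 * (∫ x, v i x * (Real.cosh (x / 2) : ℂ)) * (Real.cosh (y / 2) : ℂ) -
          2 * (∫ x, v i x * (Real.sinh (x / 2) : ℂ)) * (Real.sinh (y / 2) : ℂ) +
        (∑ n ∈ weilPrimeIndex c, (((ArithmeticFunction.vonMangoldt n : ℝ) / Real.sqrt n : ℝ) : ℂ) *
          (2 * v i y - v i (y - Real.log n) - v i (y + Real.log n))) +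
        ∫ t in Ioi 0, (weilArchDensity t : ℂ) * (2 * v i y - v i (y - t) - v i (y + t))) y -
      (weilMarkovConstant c : ℂ) * v i y)
    (W : Fin k → Fin k → ℝ) (i : Fin k) {m : ℕ} (hm : 0 < m) (R : ℝ → ℝ)
    (hR : ∀ y ∈ Ico 0 c, (F i - ∑ l, W i l • v l) y = (R y : ℂ))
    {w : ℝ → ℝ} (hwm : Measurable w) {B : ℝ} (hwB : ∀ y, |w y| ≤ B) (hwn : ∀ y, w (-y) = w y) (qw : ℕ → ℝ)
    (hq : ∀ j, j < m → ∫ ρ in (-(c / (2 * m)))..(c / (2 * m)),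
      w ((2 * j + 1) * (c / (2 * m)) + ρ) * R ((2 * j + 1) * (c / (2 * m)) + ρ) ^ 2 ≤ qw j) :
    ∫ y, w y * ‖(F i - ∑ l, W i l • v l) y‖ ^ 2 ≤ 2 * ∑ j ∈ Finset.range m, qw j := by
  set r : ℝ → ℂ := F i - ∑ l, W i l • v l with hr
  set h : ℝ := c / (2 * m) with hh
  have hmr : (0 : ℝ) < m := by exact_mod_cast hm
  have hh0 : 0 < h := by rw [hh]; positivity
  have hch : c = 2 * m * h := by rw [hh]; field_simp
  have hrm : MemLp r 2 := dt_residual_memLp hc g hg v F hv hF W i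
  have hri : Integrable fun y ↦ ‖r y‖ ^ 2 := (memLp_two_iff_integrable_sq_norm hrm.1).1 hrm
  set f : ℝ → ℝ := fun y ↦ w y * ‖r y‖ ^ 2 with hf
  have hfi : Integrable f := by
    refine Integrable.mono' (hri.const_mul B) (hwm.aestronglyMeasurable.mul hri.1) ?_
    refine Filter.Eventually.of_forall fun y ↦ ?_
    rw [hf, Real.norm_eq_abs, abs_mul, abs_of_nonneg (by positivity : (0 : ℝ) ≤ ‖r y‖ ^ 2)]
    exact mul_le_mul_of_nonneg_right (hwB y) (by positivity)
  have hf0 : ∀ y, y ∉ Icc (-c) c → f y = 0 := fun y hy ↦ by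
    simp only [hf, hr, dt_residual_zero_off hv hF i hy, norm_zero]; ring
  have hfn : ∀ y, f (-y) = f y := fun y ↦ by
    have hrn : ‖r (-y)‖ = ‖r y‖ := by
      rw [hr, dt_residual_reflect hgp hv hF i y, norm_mul, Complex.norm_real, Real.norm_eq_abs]
      rcases hσ with h1 | h1 <;> simp [h1]
    simp only [hf, hwn y, hrn]
  rw [show (∫ y, w y * ‖r y‖ ^ 2) = ∫ y, f y from rfl, dt_integral_even_eq_two_mul hc hfi hf0 hfn, hch,
    intervalIntegral_eq_sum_panels f hh0.le (fun a b _ _ ↦ hfi.intervalIntegrable) m]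
  refine mul_le_mul_of_nonneg_left (Finset.sum_le_sum fun j hj ↦ ?_) (by norm_num)
  have hjm : j < m := Finset.mem_range.1 hj
  refine le_trans (le_of_eq ?_) (hq j hjm)
  refine intervalIntegral.integral_congr_ae ?_
  have hne : ∀ᵐ ρ : ℝ ∂volume, ρ ≠ h := by rw [ae_iff]; simp
  filter_upwards [hne] with ρ hρne hρ
  rw [uIoc_of_le (by linarith)] at hρ
  have hρlt : ρ < h := lt_of_le_of_ne hρ.2 hρne
  have hj0 : (0 : ℝ) ≤ j := by exact_mod_cast Nat.zero_le j
  have hj1 : (j : ℝ) + 1 ≤ m := by exact_mod_cast hjm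
  have hy : (2 * j + 1) * h + ρ ∈ Ico 0 c := ⟨by nlinarith [hρ.1], by rw [hch]; nlinarith⟩
  simp only [hf]
  rw [show r ((2 * j + 1) * h + ρ) = (R ((2 * j + 1) * h + ρ) : ℂ) from hR _ hy, Complex.norm_real, Real.norm_eq_abs, sq_abs]

/-- **Weighted cross term from panel bounds**: `2 Σ lo_j ≤ ∫ w·Re(r_i r̄_{i'}) ≤ 2 Σ hi_j` given per-panel two-sided bounds of
`∫_{-h}^{h} w(y_j+ρ) Ri(y_j+ρ) Rk(y_j+ρ) dρ`. [cite: GoerischHaunhorst1985, §2] -/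
theorem dt_residual_wcross_mem_of_panels (hc : 0 < c) {σ : ℝ} (hσ : σ = 1 ∨ σ = -1)
    (g : Fin k → ℝ → ℝ) (hg : ∀ i, ContDiff ℝ 2 (g i)) (hgp : ∀ i x, g i (-x) = σ * g i x)
    (v F : Fin k → ℝ → ℂ) (hv : ∀ i x, v i x = (((Icc (-c) c).indicator (g i) x : ℝ) : ℂ))
    (hF : ∀ i y, F i y = (Icc (-c) c).indicator (fun y ↦
        2 * (∫ x, v i x * (Real.cosh (x / 2) : ℂ)) * (Real.cosh (y / 2) : ℂ) -
          2 * (∫ x, v i x * (Real.sinh (x / 2) : ℂ)) * (Real.sinh (y / 2) : ℂ) +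
        (∑ n ∈ weilPrimeIndex c, (((ArithmeticFunction.vonMangoldt n : ℝ) / Real.sqrt n : ℝ) : ℂ) *
          (2 * v i y - v i (y - Real.log n) - v i (y + Real.log n))) +
        ∫ t in Ioi 0, (weilArchDensity t : ℂ) * (2 * v i y - v i (y - t) - v i (y + t))) y -
      (weilMarkovConstant c : ℂ) * v i y)
    (W : Fin k → Fin k → ℝ) (i i' : Fin k) {m : ℕ} (hm : 0 < m) (Ri Rk : ℝ → ℝ)
    (hRi : ∀ y ∈ Ico 0 c, (F i - ∑ l, W i l • v l) y = (Ri y : ℂ))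
    (hRk : ∀ y ∈ Ico 0 c, (F i' - ∑ l, W i' l • v l) y = (Rk y : ℂ))
    {w : ℝ → ℝ} (hwm : Measurable w) {B : ℝ} (hwB : ∀ y, |w y| ≤ B) (hwn : ∀ y, w (-y) = w y) (lo hi : ℕ → ℝ)
    (hlo : ∀ j, j < m → lo j ≤ ∫ ρ in (-(c / (2 * m)))..(c / (2 * m)),
      w ((2 * j + 1) * (c / (2 * m)) + ρ) * (Ri ((2 * j + 1) * (c / (2 * m)) + ρ) * Rk ((2 * j + 1) * (c / (2 * m)) + ρ)))
    (hhi : ∀ j, j < m → ∫ ρ in (-(c / (2 * m)))..(c / (2 * m)),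
      w ((2 * j + 1) * (c / (2 * m)) + ρ) * (Ri ((2 * j + 1) * (c / (2 * m)) + ρ) * Rk ((2 * j + 1) * (c / (2 * m)) + ρ)) ≤ hi j) :
    2 * ∑ j ∈ Finset.range m, lo j ≤ ∫ y, w y * ((F i - ∑ l, W i l • v l) y * conj ((F i' - ∑ l, W i' l • v l) y)).re ∧
      ∫ y, w y * ((F i - ∑ l, W i l • v l) y * conj ((F i' - ∑ l, W i' l • v l) y)).re ≤ 2 * ∑ j ∈ Finset.range m, hi j := by
  set ri : ℝ → ℂ := F i - ∑ l, W i l • v l with hri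
  set rk : ℝ → ℂ := F i' - ∑ l, W i' l • v l with hrk
  set h : ℝ := c / (2 * m) with hh
  have hmr : (0 : ℝ) < m := by exact_mod_cast hm
  have hh0 : 0 < h := by rw [hh]; positivity
  have hch : c = 2 * m * h := by rw [hh]; field_simp
  -- integrability of the unweighted real cross density (polarisation) and of the weighted one
  have hmi : MemLp ri 2 := dt_residual_memLp hc g hg v F hv hF W i
  have hmk : MemLp rk 2 := dt_residual_memLp hc g hg v F hv hF W i'
  have hms : MemLp (ri + rk) 2 := hmi.add hmk
  have hIi : Integrable fun y ↦ ‖ri y‖ ^ 2 := (memLp_two_iff_integrable_sq_norm hmi.1).1 hmi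
  have hIk : Integrable fun y ↦ ‖rk y‖ ^ 2 := (memLp_two_iff_integrable_sq_norm hmk.1).1 hmk
  have hIs : Integrable fun y ↦ ‖(ri + rk) y‖ ^ 2 := (memLp_two_iff_integrable_sq_norm hms.1).1 hms
  set f0 : ℝ → ℝ := fun y ↦ (ri y * conj (rk y)).re with hf0d
  have hf0eq : f0 = fun y ↦ (‖(ri + rk) y‖ ^ 2 - ‖ri y‖ ^ 2 - ‖rk y‖ ^ 2) / 2 := by
    funext y; rw [hf0d]; simp only [Pi.add_apply]; exact dt_re_mul_conj_eq _ _
  have hf0i : Integrable f0 := by rw [hf0eq]; exact ((hIs.sub hIi).sub hIk).div_const 2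
  set f : ℝ → ℝ := fun y ↦ w y * f0 y with hf
  have hfi : Integrable f := by
    refine Integrable.mono' ((hf0i.norm).const_mul B) (hwm.aestronglyMeasurable.mul hf0i.1) ?_
    refine Filter.Eventually.of_forall fun y ↦ ?_
    rw [hf, Real.norm_eq_abs, abs_mul, Real.norm_eq_abs]
    exact mul_le_mul_of_nonneg_right (hwB y) (abs_nonneg _)
  have hfy : ∀ y ∈ Ico 0 c, f0 y = Ri y * Rk y := fun y hy ↦ by
    simp only [hf0d]
    rw [hRi y hy, hRk y hy, Complex.conj_ofReal, ← Complex.ofReal_mul, Complex.ofReal_re]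
  have hf00 : ∀ y, y ∉ Icc (-c) c → f y = 0 := fun y hy ↦ by
    simp only [hf, hf0d, hri, dt_residual_zero_off hv hF i hy, zero_mul, Complex.zero_re, mul_zero]
  have hfn : ∀ y, f (-y) = f y := fun y ↦ by
    have h0 : f0 (-y) = f0 y := by
      simp only [hf0d, hri, hrk, dt_residual_reflect hgp hv hF i y, dt_residual_reflect hgp hv hF i' y, map_mul,
        Complex.conj_ofReal]
      have e : (σ : ℂ) * (F i - ∑ l, W i l • v l) y * ((σ : ℂ) * conj ((F i' - ∑ l, W i' l • v l) y)) =
          ((σ : ℂ) * σ) * ((F i - ∑ l, W i l • v l) y * conj ((F i' - ∑ l, W i' l • v l) y)) := by ring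
      have hs : (σ : ℂ) * σ = 1 := by rcases hσ with h1 | h1 <;> simp [h1]
      rw [e, hs, one_mul]
    simp only [hf, hwn y, h0]
  rw [show (∫ y, w y * (ri y * conj (rk y)).re) = ∫ y, f y from rfl, dt_integral_even_eq_two_mul hc hfi hf00 hfn, hch,
    intervalIntegral_eq_sum_panels f hh0.le (fun a b _ _ ↦ hfi.intervalIntegrable) m]
  have hpanel : ∀ j ∈ Finset.range m, ∫ ρ in (-h)..h, f ((2 * j + 1) * h + ρ) =
      ∫ ρ in (-h)..h, w ((2 * j + 1) * h + ρ) * (Ri ((2 * j + 1) * h + ρ) * Rk ((2 * j + 1) * h + ρ)) := by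
    intro j hj
    have hjm : j < m := Finset.mem_range.1 hj
    refine intervalIntegral.integral_congr_ae ?_
    have hne : ∀ᵐ ρ : ℝ ∂volume, ρ ≠ h := by rw [ae_iff]; simp
    filter_upwards [hne] with ρ hρne hρ
    rw [uIoc_of_le (by linarith)] at hρ
    have hρlt : ρ < h := lt_of_le_of_ne hρ.2 hρne
    have hj0 : (0 : ℝ) ≤ j := by exact_mod_cast Nat.zero_le j
    have hj1 : (j : ℝ) + 1 ≤ m := by exact_mod_cast hjm
    simp only [hf]
    rw [hfy _ ⟨by nlinarith [hρ.1], by rw [hch]; nlinarith⟩]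
  rw [Finset.sum_congr rfl hpanel]
  constructor
  · have := Finset.sum_le_sum fun j hj ↦ hlo j (Finset.mem_range.1 hj)
    linarith
  · have := Finset.sum_le_sum fun j hj ↦ hhi j (Finset.mem_range.1 hj)
    linarith

end WAssembly

end Summit.RiemannHypothesis.RiemannHypothesis.Theorems.EvenWinsBeyondArch

end
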